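import Literature.Probability.RandomPlanarGeometry.LoewnerEulerScheme
import Literature.Probability.RandomPlanarGeometry.LoewnerRealPointProofs
import Literature.Probability.RandomPlanarGeometry.RestrictionContinuity
import HarnessLib

/-!
# Hulls of continuous driving functions are limits of `𝒜₀`; [LSW] Lemma 3.5 from Loewner's theorem

G. F. Lawler, O. Schramm, W. Werner, *Conformal restriction: the chordal case*, J. Amer. Math.
Soc. **16** (2003) 917–955, arXiv:math/0209343 (**[LSW]**), proof of Lemma 3.5, p. 13 (the
Loewner half of the density of `𝒜₀` in `𝒬₊`; quoted in `RestrictionDensityArc` and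
`LoewnerEulerScheme`).

This file completes the Euler-scheme analysis of `LoewnerEulerScheme` into the convergence
`B_N → K` in the sense of [LSW] p. 12 (`LSWClosedConverges`, `RestrictionDensityArc`) for the
closed hull `K = closure (K_S)` of the chordal Loewner chain of ANY continuous driving function
`W` with `W_0 > 0` and `K ∈ 𝒬₊`:

* `Literature.Probability.RandomPlanarGeometry.Loewner.normalizedMap` — the restriction map
  `Φ_K = g_S - g_S(0)` of `K` (`isRestrictionMap_normalizedMap`), and the positivity
  `Ũ_t = W_t - g_t(0) ≥ λ₋ > 0` on `[0, S]` (`exists_forall_le_driving_sub_map_zero`);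
* `Literature.Probability.RandomPlanarGeometry.Loewner.continuousOn_map_prod` — joint continuity
  of `(t, z) ↦ g_t(z)` on `[0, S] × {S < T_z}`, whence on every compact of `ℍ̄ ∖ K'` the flow
  stays `δ`-away from `W` (`exists_forall_le_norm_map_sub`);
* `Literature.Probability.RandomPlanarGeometry.Loewner.exists_lswClosedConverges_closure_hull` —
  **PROVED: `K = closure (hull W S)` is an `LSWClosedConverges`-limit of the Euler hulls
  `B_N ∈ 𝒜₀`** (for every restriction map of `K`): eventual disjointness from compacts by
  `mem_diff_eulerStage`, uniform convergence by `dist_eulerMap_map_le` (the offsets absorbing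
  the normalization), the uniform annulus by Lawler's Lemma 4.13 (`lt_swallowingTime_of_far`)
  outside and a small half-disc inside.

and then reduces the named fact `IsArcHull.exists_isLSWGenerated_lswClosedConverges` of
`RestrictionDensityArc` (hence the density `IsPlusHull.exists_isLSWGenerated_lswConverges` of
`RestrictionDensity`) to **Loewner's theorem for the boundary path of a smooth hull**:

* NAMED FACT `Literature.Probability.RandomPlanarGeometry.IsArcHull.exists_loewner_chain` —
  [LSW] p. 13: "Note that `∂E_δ ∩ ℍ̄` is a simple path, say `β : [0, s] → ℍ̄` with
  `β(0), β(s) ∈ ℝ`. We may assume that `β` is parametrized by half-plane capacity … Set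
  `g_t := g_{β[0,t]}` …, `U_t := g_t(β(t))` … By the chordal version of Loewner's theorem, we have
  `∂_t g_t(z) = 2/(g_t(z) - U_t)`" (Lawler (2005), Prop. 4.4 with Lemma 4.2 and Remark 4.5),
  in the tree's terms: the boundary arc of an arc hull `A ∈ 𝒬₊`, reparametrized, is the family
  of hulls of the Loewner chain of a continuous driving function `W` with `W_0 = γ(0)`, whose
  hull at the terminal time is `A ∩ ℍ` (`Φ_s = Φ_{E_δ}`);
* PROVED `IsArcHull.exists_isLSWGenerated_lswClosedConverges_of_loewner` and
  `IsPlusHull.exists_isLSWGenerated_lswConverges_of_loewner` — **the density of `𝒜₀` in `𝒬₊`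
  ([LSW] Lemma 3.5) follows from Loewner's theorem.**

## References

* [LSW] proof of Lemma 3.5, arXiv pp. 12–13 [LawlerSchrammWerner2003Restriction].
* G. F. Lawler, *Conformally Invariant Processes in the Plane*, AMS (2005), §4.1 (Prop. 4.4,
  Lemma 4.2, Rem. 4.5, Lemma 4.13), §4.7 (Prop. 4.47) [Lawler2005].
-/

noncomputable section

open Set Filter Metric Complex Bornology
open UpperHalfPlane (upperHalfPlaneSet isOpen_upperHalfPlaneSet)
open scoped NNReal Topology Pointwise

namespace Literature.Probability.RandomPlanarGeometry

namespace Loewner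

variable {W : ℝ≥0 → ℝ} {S : ℝ≥0}

/-! ### The closed hull `K = closure K_S` and the normalized map -/

/-- Points flowing beyond `S` are off the closed hull. [folklore] -/
theorem notMem_closure_hull_of_lt (hW : Continuous W) {z : ℂ}
    (hz : (S : WithTop ℝ≥0) < swallowingTime W z) : z ∉ closure (hull W S) := by
  intro hmem
  rw [mem_closure_iff_nhds] at hmem
  obtain ⟨w, hw, hwt⟩ := hmem _ ((isOpen_setOf_lt_swallowingTime hW S).mem_nhds hz)
  exact absurd hwt.2 (not_le.2 hw)

/-- `closure (K_S) ∩ ℍ = K_S`. [folklore] -/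
theorem closure_hull_inter (hW : Continuous W) : closure (hull W S) ∩ upperHalfPlaneSet = hull W S := by
  refine Subset.antisymm ?_ fun z hz ↦ ⟨subset_closure hz, hz.1⟩
  rintro z ⟨hz, hzH⟩
  by_contra hzK
  have hdom : z ∈ domain W S := ⟨hzH, hzK⟩
  exact notMem_closure_hull_of_lt hW ((mem_domain_iff _ _ _).1 hdom).2 hz

/-- `ℍ ∖ closure (K_S) = H_S`. [folklore] -/
theorem diff_closure_hull (hW : Continuous W) : upperHalfPlaneSet \ closure (hull W S) = domain W S := by
  ext z
  constructor
  · rintro ⟨hzH, hzK⟩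
    exact ⟨hzH, fun h ↦ hzK (subset_closure h)⟩
  · rintro ⟨hzH, hzK⟩
    refine ⟨hzH, fun h ↦ hzK ?_⟩
    rw [← closure_hull_inter hW]
    exact ⟨h, hzH⟩

/-- **The origin flows beyond `S` when `0 ∉ closure K_S`** (and `W_0 ≠ 0`): real points off the
closed hull are alive (`lt_swallowingTime_of_notMem_closure_hull_holds`). [folklore] -/
theorem lt_swallowingTime_zero (hW : Continuous W) (hW0 : W 0 ≠ 0)
    (h0 : (0 : ℂ) ∉ closure (hull W S)) : (S : WithTop ℝ≥0) < swallowingTime W 0 := by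
  have hx : ((0 : ℝ) : ℂ) ≠ ((W 0 : ℝ) : ℂ) := by exact_mod_cast (Ne.symm hW0)
  have h := lt_swallowingTime_of_notMem_closure_hull_holds hW hx (t := S) (by simpa using h0)
  simpa using h

/-- `g_t(0) ≠ W_t` while `0` flows (solutions avoid the singularity). [folklore] -/
theorem map_origin_ne_driving (hW : Continuous W) {t : ℝ≥0}
    (ht : (t : WithTop ℝ≥0) < swallowingTime W 0) : map W t 0 ≠ W t := by
  obtain ⟨g, hg⟩ := exists_isSolution_swallowingTime_holds hW (ne_driving_of_lt_swallowingTime ht)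
  rw [map_eq_of_isSolution hW hg ht]
  have := hg.ne t.coe_nonneg (by simpa using ht)
  simpa using this

/-- `g_t(0)` is the real number `re g_t(0)`. [folklore] -/
theorem map_origin_eq_re (hW : Continuous W) {t : ℝ≥0} (ht : (t : WithTop ℝ≥0) < swallowingTime W 0) :
    map W t 0 = (((map W t 0).re : ℝ) : ℂ) := by
  conv_lhs => rw [← Complex.re_add_im (map W t 0), im_map_origin hW ht]
  simp

/-- **The normalized driving function `Ũ_t = W_t - g_t(0)` is positive and bounded below on
`[0, S]`** when `W_0 > 0` and `0` flows beyond `S` ([LSW] p. 13: "Since `Ũ_t` is continuous and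
positive"): it is continuous, never `0` (`g_t(0) ≠ W_t`), and `Ũ_0 = W_0 > 0`, so the
intermediate value theorem and compactness give `λ₋ > 0` with `Ũ ≥ λ₋`.
[cite: LawlerSchrammWerner2003Restriction, proof of Lemma 3.5 (p. 13)] -/
theorem exists_forall_le_driving_sub_map_zero (hW : Continuous W) (hW0 : 0 < W 0)
    (h0 : (S : WithTop ℝ≥0) < swallowingTime W 0) :
    ∃ lam : ℝ, 0 < lam ∧ ∀ t : ℝ≥0, t ≤ S → lam ≤ W t - (map W t 0).re := by
  set U : ℝ≥0 → ℝ := fun t ↦ W t - (map W t 0).re with hUdef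
  have hUc : ContinuousOn U (Iic S) :=
    (hW.continuousOn).sub (Complex.continuous_re.comp_continuousOn (continuousOn_map_apply hW h0))
  have hUne : ∀ t ∈ Iic S, U t ≠ 0 := by
    intro t ht hUt
    have htT : (t : WithTop ℝ≥0) < swallowingTime W 0 := lt_of_le_of_lt (WithTop.coe_le_coe.2 ht) h0
    apply map_origin_ne_driving hW htT
    rw [map_origin_eq_re hW htT]
    have : (map W t 0).re = W t := by simp only [hUdef] at hUt; linarith
    rw [this]
  have hU0 : 0 < U 0 := by
    have h00 : (0 : ℂ) ≠ W 0 := by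
      intro h; have := congrArg Complex.re h; simp at this; linarith
    simp only [hUdef, map_zero_apply hW h00, Complex.zero_re, sub_zero]
    exact hW0
  -- positivity on `[0, S]` by the intermediate value theorem
  have hpos : ∀ t ∈ Iic S, 0 < U t := by
    intro t ht
    by_contra hle
    push Not at hle
    have hIcc : Icc (0 : ℝ≥0) t ⊆ Iic S := fun s hs ↦ hs.2.trans ht
    have hmem : (0 : ℝ) ∈ Icc (U t) (U 0) := ⟨hle, hU0.le⟩
    obtain ⟨s, hs, hs0⟩ := intermediate_value_Icc' (by simp : (0 : ℝ≥0) ≤ t) (hUc.mono hIcc) hmem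
    exact hUne s (hIcc hs) hs0
  -- minimum on the compact `[0, S]`
  have hIcc : Icc (0 : ℝ≥0) S ⊆ Iic S := fun s hs ↦ hs.2
  obtain ⟨t₀, ht₀, hmin⟩ := (isCompact_Icc (a := (0 : ℝ≥0)) (b := S)).exists_isMinOn
    ⟨0, by simp⟩ (hUc.mono hIcc)
  exact ⟨U t₀, hpos t₀ (hIcc ht₀), fun t ht ↦ hmin (show t ∈ Icc 0 S from ⟨by simp, ht⟩)⟩

section Normalized

variable (hW : Continuous W) (S)

/-- **The normalized Loewner map `Φ_S = g_S - g_S(0)`** as a conformal equivalence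
`ℍ ∖ closure (K_S) → ℍ` (the Loewner map `conformalEquivMap` followed by the real translation
by `-re g_S(0)`; [LSW] p. 13: "`Φ_t := Φ_{β[0,t]} = g_t - g_t(0)`").
[cite: LawlerSchrammWerner2003Restriction, proof of Lemma 3.5 (p. 13)] -/
def normalizedMap : ConformalEquiv (upperHalfPlaneSet \ closure (hull W S)) upperHalfPlaneSet :=
  ((conformalEquivMap hW S).trans (addRealUpperHalfPlane (-(map W S 0).re))).copy
    (upperHalfPlaneSet \ closure (hull W S)) upperHalfPlaneSet (diff_closure_hull hW) rfl

/-- `Φ_S(z) = g_S(z) - re g_S(0)`. [folklore] -/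
@[simp] theorem normalizedMap_apply (z : ℂ) :
    normalizedMap S hW z = map W S z - (((map W S 0).re : ℝ) : ℂ) := by
  simp only [normalizedMap, ConformalEquiv.copy_apply, ConformalEquiv.trans_apply,
    conformalEquivMap_apply, addRealUpperHalfPlane_apply]
  push_cast
  ring

variable {S hW}

/-- **`Φ_S` is a restriction map of `closure (K_S)`** when `0` flows beyond `S`: boundary value
`0` at `0` (continuity of the flow at the origin, `g_S(0)` real) and `Φ_S(z)/z → 1` at `∞`
(hydrodynamic normalisation `g_S(z) - z → 0`). [cite: LawlerSchrammWerner2003Restriction, proof of Lemma 3.5 (p. 13)] -/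
theorem isRestrictionMap_normalizedMap (h0 : (S : WithTop ℝ≥0) < swallowingTime W 0) :
    IsRestrictionMap (closure (hull W S)) (normalizedMap S hW) := by
  refine ⟨?_, ?_⟩
  · change Tendsto (normalizedMap S hW) (𝓝[upperHalfPlaneSet \ closure (hull W S)] 0) (𝓝 0)
    have hc : ContinuousAt (map W S) 0 := continuousAt_map hW h0
    have h1 : Tendsto (fun z ↦ map W S z - (((map W S 0).re : ℝ) : ℂ)) (𝓝 0)
        (𝓝 (map W S 0 - (((map W S 0).re : ℝ) : ℂ))) :=
      hc.tendsto.sub tendsto_const_nhds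
    have h2 : map W S 0 - (((map W S 0).re : ℝ) : ℂ) = 0 := by
      rw [sub_eq_zero]; exact map_origin_eq_re hW h0
    rw [h2] at h1
    refine (h1.mono_left nhdsWithin_le_nhds).congr fun z ↦ ?_
    rw [normalizedMap_apply]
  · have hF : cocompact ℂ ⊓ 𝓟 (upperHalfPlaneSet \ closure (hull W S)) ≤ cocompact ℂ ⊓ 𝓟 upperHalfPlaneSet :=
      inf_le_inf_left _ (principal_mono.2 sdiff_subset)
    set c : ℂ := (((map W S 0).re : ℝ) : ℂ) with hc
    have h1 : Tendsto (fun z ↦ map W S z - z)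
        (cocompact ℂ ⊓ 𝓟 (upperHalfPlaneSet \ closure (hull W S))) (𝓝 0) :=
      (tendsto_map_sub_self_holds hW S).mono_left hF
    have h2 : Tendsto (fun z ↦ map W S z - z - c)
        (cocompact ℂ ⊓ 𝓟 (upperHalfPlaneSet \ closure (hull W S))) (𝓝 (0 - c)) :=
      h1.sub tendsto_const_nhds
    have h3 : Tendsto (fun z : ℂ ↦ z⁻¹) (cocompact ℂ ⊓ 𝓟 (upperHalfPlaneSet \ closure (hull W S))) (𝓝 0) := by
      refine Tendsto.mono_left ?_ inf_le_left
      rw [← cobounded_eq_cocompact]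
      exact tendsto_inv₀_cobounded
    have h4 := (h2.mul h3).const_add 1
    rw [mul_zero, add_zero] at h4
    refine h4.congr' ?_
    have hev : ∀ᶠ z : ℂ in cocompact ℂ ⊓ 𝓟 (upperHalfPlaneSet \ closure (hull W S)), z ≠ 0 :=
      mem_inf_of_left (isCompact_singleton.compl_mem_cocompact)
    filter_upwards [hev] with z hz
    rw [normalizedMap_apply]
    field_simp
    ring

end Normalized

/-! ### Joint continuity of the flow and the distance to the driving function on compacts -/

/-- **Joint continuity of `(t, z) ↦ g_t(z)`** on `[0, S] × {S < T_z}` (continuous dependence on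
the starting point uniformly in time, `IsSolution.exists_forall_dist_lt`, and continuity in
time of each solution). [cite: Lawler2005, Ch. 4 §4.1] -/
theorem continuousOn_map_prod (hW : Continuous W) :
    ContinuousOn (fun p : ℝ≥0 × ℂ ↦ map W p.1 p.2)
      (Iic S ×ˢ {z : ℂ | (S : WithTop ℝ≥0) < swallowingTime W z}) := by
  rintro ⟨t₀, z₀⟩ ⟨ht₀, hz₀⟩
  simp only [mem_Iic, mem_setOf_eq] at ht₀ hz₀
  rw [Metric.continuousWithinAt_iff]
  intro ε hε
  obtain ⟨g, hg⟩ := exists_isSolution_swallowingTime_holds hW (ne_driving_of_lt_swallowingTime hz₀)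
  obtain ⟨ρ, hρ, hdep⟩ := hg.exists_forall_dist_lt hW hz₀ (half_pos hε)
  -- continuity in time of `g` at `t₀`
  have hgc : ContinuousWithinAt (fun u : ℝ≥0 ↦ g u) (Iic S) t₀ := by
    have hc := hg.continuousOn
    have h1 : ContinuousWithinAt g {s : ℝ | 0 ≤ s ∧ (s.toNNReal : WithTop ℝ≥0) < swallowingTime W z₀} t₀ :=
      hc t₀ ⟨t₀.coe_nonneg, by simpa using lt_of_le_of_lt (WithTop.coe_le_coe.2 ht₀) hz₀⟩
    refine (h1.comp (f := fun u : ℝ≥0 ↦ (u : ℝ)) continuous_subtype_val.continuousWithinAt ?_)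
    intro u hu
    exact ⟨u.coe_nonneg, by simpa using lt_of_le_of_lt (WithTop.coe_le_coe.2 hu) hz₀⟩
  obtain ⟨δ₁, hδ₁, hgt⟩ := Metric.continuousWithinAt_iff.1 hgc (ε / 2) (half_pos hε)
  refine ⟨min ρ δ₁, lt_min hρ hδ₁, ?_⟩
  rintro ⟨t, z⟩ ⟨ht, hzT'⟩ hdist
  simp only [mem_Iic, mem_setOf_eq] at ht hzT'
  have hdt : dist t t₀ < δ₁ := by
    have := (Prod.dist_eq (x := (t, z)) (y := (t₀, z₀))) ▸ hdist
    exact (le_max_left _ _).trans_lt (this.trans_le (min_le_right _ _))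
  have hdz : dist z z₀ < ρ := by
    have := (Prod.dist_eq (x := (t, z)) (y := (t₀, z₀))) ▸ hdist
    exact (le_max_right _ _).trans_lt (this.trans_le (min_le_left _ _))
  obtain ⟨hzT, hclose⟩ := hdep z hdz
  obtain ⟨h, hh⟩ := exists_isSolution_swallowingTime_holds hW (ne_driving_of_lt_swallowingTime hzT)
  have htT : (t : WithTop ℝ≥0) < swallowingTime W z := lt_of_le_of_lt (WithTop.coe_le_coe.2 ht) hzT
  have htT₀ : (t₀ : WithTop ℝ≥0) < swallowingTime W z₀ := lt_of_le_of_lt (WithTop.coe_le_coe.2 ht₀) hz₀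
  have h1 := hclose h _ hh t t.coe_nonneg ht (by simpa using htT)
  have h2 := hgt ht hdt
  show dist (map W t z) (map W t₀ z₀) < ε
  rw [map_eq_of_isSolution hW hh htT, map_eq_of_isSolution hW hg htT₀]
  calc dist (h t) (g t₀) ≤ dist (h t) (g t) + dist (g t) (g t₀) := dist_triangle _ _ _
    _ < ε / 2 + ε / 2 := add_lt_add h1 h2
    _ = ε := by ring

/-- **On a compact set of points flowing beyond `S` the flow stays uniformly away from the
driving function**: `inf {|g_t(z) - W_t| : t ≤ S, z ∈ C} > 0` (joint continuity and
`g_t(z) ≠ W_t`; the set `V_δ` of Lawler (2005), proof of Prop. 4.47). [cite: Lawler2005, Ch. 4 §4.7 (Prop. 4.47)] -/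
theorem exists_forall_le_norm_map_sub (hW : Continuous W) {C : Set ℂ} (hC : IsCompact C)
    (hCT : ∀ z ∈ C, (S : WithTop ℝ≥0) < swallowingTime W z) :
    ∃ δ : ℝ≥0, 0 < δ ∧ ∀ z ∈ C, ∀ t : ℝ≥0, t ≤ S → (δ : ℝ) ≤ ‖map W t z - W t‖ := by
  rcases C.eq_empty_or_nonempty with rfl | hCne
  · exact ⟨1, one_pos, fun z hz ↦ absurd hz (notMem_empty _)⟩
  set F : ℝ≥0 × ℂ → ℝ := fun p ↦ ‖map W p.1 p.2 - W p.1‖ with hF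
  have hP : IsCompact (Icc 0 S ×ˢ C) := (isCompact_Icc (a := (0 : ℝ≥0)) (b := S)).prod hC
  have hsub : Icc 0 S ×ˢ C ⊆ Iic S ×ˢ {z : ℂ | (S : WithTop ℝ≥0) < swallowingTime W z} :=
    prod_mono (fun s hs ↦ hs.2) fun z hz ↦ hCT z hz
  have hFc : ContinuousOn F (Icc 0 S ×ˢ C) :=
    (((continuousOn_map_prod hW).mono hsub).sub
      ((Complex.continuous_ofReal.comp (hW.comp continuous_fst)).continuousOn)).norm
  obtain ⟨⟨t₀, z₀⟩, hp₀, hmin⟩ := hP.exists_isMinOn (Set.Nonempty.prod ⟨0, by simp⟩ hCne) hFc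
  have hpos : 0 < F (t₀, z₀) := by
    have ht₀ : t₀ ≤ S := hp₀.1.2
    have hzT : (t₀ : WithTop ℝ≥0) < swallowingTime W z₀ :=
      lt_of_le_of_lt (WithTop.coe_le_coe.2 ht₀) (hCT z₀ hp₀.2)
    obtain ⟨g, hg⟩ := exists_isSolution_swallowingTime_holds hW (ne_driving_of_lt_swallowingTime hzT)
    simp only [hF]
    rw [map_eq_of_isSolution hW hg hzT]
    have := hg.ne t₀.coe_nonneg (by simpa using hzT)
    exact norm_pos_iff.2 (sub_ne_zero.2 (by simpa using this))
  refine ⟨⟨F (t₀, z₀), hpos.le⟩, hpos, fun z hz t ht ↦ ?_⟩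
  exact hmin (show (t, z) ∈ Icc 0 S ×ˢ C from ⟨⟨by simp, ht⟩, hz⟩)

/-! ### The uniform annulus: finitely many exceptions -/

/-- The annulus `{δ ≤ |z| ≤ 1/δ}` grows as `δ` decreases. [folklore] -/
theorem annulus_mono {δ δ' : ℝ} (hδ' : 0 < δ') (h : δ' ≤ δ) :
    {z : ℂ | δ ≤ ‖z‖ ∧ ‖z‖ ≤ δ⁻¹} ⊆ {z : ℂ | δ' ≤ ‖z‖ ∧ ‖z‖ ≤ δ'⁻¹} := fun _ hz ↦
  ⟨h.trans hz.1, hz.2.trans (inv_anti₀ hδ' h)⟩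

/-- **Eventually uniform plus individually bounded is uniform**: `*`-hulls lying in a fixed
annulus for all large `n` lie in a (larger) fixed annulus for all `n`. [folklore] -/
theorem exists_forall_subset_annulus {A : ℕ → Set ℂ} (hA : ∀ n, IsStarHull (A n)) {δ₁ : ℝ}
    (hδ₁ : 0 < δ₁) (hev : ∀ᶠ n in atTop, A n ⊆ {z : ℂ | δ₁ ≤ ‖z‖ ∧ ‖z‖ ≤ δ₁⁻¹}) :
    ∃ δ : ℝ, 0 < δ ∧ ∀ n, A n ⊆ {z : ℂ | δ ≤ ‖z‖ ∧ ‖z‖ ≤ δ⁻¹} := by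
  obtain ⟨N₁, hN₁⟩ := eventually_atTop.1 hev
  -- induction on the number of exceptions
  have aux : ∀ N : ℕ, ∀ δ' : ℝ, 0 < δ' → (∀ n, N ≤ n → A n ⊆ {z : ℂ | δ' ≤ ‖z‖ ∧ ‖z‖ ≤ δ'⁻¹}) →
      ∃ δ : ℝ, 0 < δ ∧ ∀ n, A n ⊆ {z : ℂ | δ ≤ ‖z‖ ∧ ‖z‖ ≤ δ⁻¹} := by
    intro N
    induction N with
    | zero => exact fun δ' hδ' h ↦ ⟨δ', hδ', fun n ↦ h n (Nat.zero_le n)⟩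
    | succ N ih =>
      intro δ' hδ' h
      obtain ⟨δ₀, hδ₀, hδ₀A⟩ := (hA N).exists_subset_norm_annulus
      refine ih (min δ' δ₀) (lt_min hδ' hδ₀) fun n hn ↦ ?_
      rcases hn.lt_or_eq with hlt | rfl
      · exact (h n hlt).trans (annulus_mono (lt_min hδ' hδ₀) (min_le_left _ _))
      · exact hδ₀A.trans (annulus_mono (lt_min hδ' hδ₀) (min_le_right _ _))
  exact aux N₁ δ₁ hδ₁ hN₁

/-! ### The approximation theorem -/

section Approx

variable (hW : Continuous W) (hS : 0 < S) (hW0 : 0 < W 0) (hKp : IsPlusHull (closure (hull W S)))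
include hW hS hW0 hKp

omit hS in
/-- **The Euler scheme is eventually good, uniformly on `δ`-good points** (`δ ≤ λ₋`): for every
`ε' > 0` and all large `N`, all levels are positive and every point flowing beyond `S` at
distance `≥ δ` from `W` has all its Euler steps alive and `|G^E_{N+1} - g_S| ≤ ε'` there
(`dist_eulerMap_map_le` with `ω₀` from the uniform continuity of `W` on `[0, S]` and `Δ → 0`).
[cite: LawlerSchrammWerner2003Restriction, proof of Lemma 3.5 (p. 13)] -/
theorem eventually_euler_good {lam : ℝ} (hU : ∀ t : ℝ≥0, t ≤ S → lam ≤ W t - (map W t 0).re)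
    {δ : ℝ≥0} (hδ : 0 < δ) (hδlam : (δ : ℝ) ≤ lam) {ε' : ℝ} (hε' : 0 < ε') :
    ∀ᶠ N in atTop, (∀ j, j < N + 1 → 0 < eulerLevel W S N j) ∧
      ∀ y : ℂ, (S : WithTop ℝ≥0) < swallowingTime W y →
        (∀ t : ℝ≥0, t ≤ S → (δ : ℝ) ≤ ‖map W t y - W t‖) →
        (∀ j, j < N + 1 → (eulerStep S N : WithTop ℝ≥0) <
            swallowingTime (eulerDriving W S N j) (eulerMap W S N j y)) ∧
          dist (eulerMap W S N (N + 1) y) (map W S y) ≤ ε' := by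
  have hδ' : (0 : ℝ) < δ := hδ
  have hlam : 0 < lam := hδ'.trans_le hδlam
  have h0 : (S : WithTop ℝ≥0) < swallowingTime W 0 := lt_swallowingTime_zero hW hW0.ne' hKp.1.2
  -- the constants
  set K : ℝ := 2 / ((δ : ℝ) / 2) ^ 2 with hKdef
  set M : ℝ := Real.exp (K * S) - 1 with hMdef
  have hM0 : 0 ≤ M := by rw [hMdef]; linarith [Real.one_le_exp (show 0 ≤ K * S by positivity)]
  set ωs : ℝ := min ((δ : ℝ) / 4) (min ε' ((δ : ℝ) / 8)) / (M + 1) with hωsdef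
  have hωs : 0 < ωs := by rw [hωsdef]; positivity
  have hωs1 : ωs * (M + 1) = min ((δ : ℝ) / 4) (min ε' ((δ : ℝ) / 8)) := by
    rw [hωsdef]; field_simp
  have hωsδ4 : ωs ≤ δ / 4 := by
    have : ωs ≤ ωs * (M + 1) := le_mul_of_one_le_right hωs.le (by linarith)
    exact this.trans (hωs1 ▸ min_le_left _ _)
  -- uniform continuity of `W` on `[0, S]`
  have huc : UniformContinuousOn W (Icc 0 S) :=
    (isCompact_Icc (a := (0 : ℝ≥0)) (b := S)).uniformContinuousOn_of_continuous hW.continuousOn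
  obtain ⟨η, hη, hηW⟩ := Metric.uniformContinuousOn_iff.1 huc (ωs / 2) (half_pos hωs)
  -- `Δ_N → 0`
  have hΔ : Tendsto (fun N : ℕ ↦ (eulerStep S N : ℝ)) atTop (𝓝 0) := by
    have h1 := (tendsto_one_div_add_atTop_nhds_zero_nat).const_mul (S : ℝ)
    rw [mul_zero] at h1
    refine h1.congr fun N ↦ ?_
    simp only [eulerStep, NNReal.coe_div, NNReal.coe_add, NNReal.coe_natCast, NNReal.coe_one]
    ring
  have hev1 : ∀ᶠ N : ℕ in atTop, (eulerStep S N : ℝ) < η := hΔ.eventually (gt_mem_nhds hη)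
  have hev2 : ∀ᶠ N : ℕ in atTop, 4 * (eulerStep S N : ℝ) / lam < ωs / 2 := by
    have h1 : Tendsto (fun N : ℕ ↦ 4 * (eulerStep S N : ℝ) / lam) atTop (𝓝 (4 * 0 / lam)) :=
      (hΔ.const_mul 4).div_const lam
    rw [mul_zero, zero_div] at h1
    exact h1.eventually (gt_mem_nhds (half_pos hωs))
  filter_upwards [hev1, hev2] with N hN1 hN2
  -- the hypotheses of `dist_eulerMap_map_le`
  have hosc : ∀ s u : ℝ≥0, s + u ≤ S → u ≤ eulerStep S N → |W (s + u) - W s| ≤ ωs / 2 := by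
    intro s u hsu hu
    have hs : s ∈ Icc (0 : ℝ≥0) S := ⟨zero_le, le_self_add.trans hsu⟩
    have hsu' : s + u ∈ Icc (0 : ℝ≥0) S := ⟨zero_le, hsu⟩
    have hd : dist (s + u) s < η := by
      rw [NNReal.dist_eq, NNReal.coe_add, add_sub_cancel_left, abs_of_nonneg u.coe_nonneg]
      exact (NNReal.coe_le_coe.2 hu).trans_lt hN1
    have := hηW (s + u) hsu' s hs hd
    rw [Real.dist_eq] at this
    exact this.le
  have hω4 : ωs / 2 + 4 * (eulerStep S N : ℝ) / lam ≤ δ / 4 := by linarith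
  have hωle : ωs / 2 + 4 * (eulerStep S N : ℝ) / lam ≤ ωs := by linarith
  have hωpos : 0 ≤ ωs / 2 + 4 * (eulerStep S N : ℝ) / lam := by positivity
  have hωM : (ωs / 2 + 4 * (eulerStep S N : ℝ) / lam) * M ≤ min ((δ : ℝ) / 4) (min ε' ((δ : ℝ) / 8)) := by
    calc (ωs / 2 + 4 * (eulerStep S N : ℝ) / lam) * M ≤ ωs * M := mul_le_mul_of_nonneg_right hωle hM0
      _ ≤ ωs * (M + 1) := by nlinarith
      _ = _ := hωs1
  have hωS : (ωs / 2 + 4 * (eulerStep S N : ℝ) / lam) * (Real.exp (2 / ((δ : ℝ) / 2) ^ 2 * S) - 1) < δ / 4 := by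
    rw [← hKdef, ← hMdef]
    have h1 : min ((δ : ℝ) / 4) (min ε' ((δ : ℝ) / 8)) ≤ (δ : ℝ) / 8 :=
      (min_le_right _ _).trans (min_le_right _ _)
    linarith [hωM.trans h1]
  have hωε : (ωs / 2 + 4 * (eulerStep S N : ℝ) / lam) * (Real.exp (2 / ((δ : ℝ) / 2) ^ 2 * S) - 1) ≤ ε' := by
    rw [← hKdef, ← hMdef]
    exact hωM.trans ((min_le_right _ _).trans (min_le_left _ _))
  -- `0` is a good point, which gives the positivity of the levels
  have hfar0 : ∀ t : ℝ≥0, t ≤ S → (δ : ℝ) ≤ ‖map W t 0 - W t‖ := by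
    intro t ht
    have h1 := abs_re_le_norm (map W t 0 - W t)
    rw [Complex.sub_re, Complex.ofReal_re] at h1
    have h2 := hU t ht
    have h3 : |(map W t 0).re - W t| = W t - (map W t 0).re := by
      rw [abs_sub_comm, abs_of_nonneg (by linarith)]
    linarith
  have key := fun (y : ℂ) (hyS : (S : WithTop ℝ≥0) < swallowingTime W y)
      (hfar : ∀ t : ℝ≥0, t ≤ S → (δ : ℝ) ≤ ‖map W t y - W t‖) ↦
    dist_eulerMap_map_le (N := N) hW h0 hU hδ hδlam (half_pos hωs).le hosc hω4 hωS hyS hfar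
  refine ⟨fun j hj ↦ ?_, fun y hyS hfar ↦ ⟨(key y hyS hfar).2.1, (key y hyS hfar).2.2.trans hωε⟩⟩
  have := (key 0 h0 hfar0).1 j hj
  linarith

omit hW0 hKp in
/-- **Points of `ℍ̄` off `K' = realFill K` flow beyond `S`**: points of `ℍ ∖ K = H_S` by
definition, real points off the closed hull by `lt_swallowingTime_of_notMem_closure_hull_holds`
(they are `≠ W_0 ∈ K`). [folklore] -/
theorem lt_swallowingTime_of_notMem_realFill {y : ℂ} (hy : y ∈ closure upperHalfPlaneSet)
    (hyK : y ∉ realFill (closure (hull W S))) : (S : WithTop ℝ≥0) < swallowingTime W y := by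
  have hyK' : y ∉ closure (hull W S) := fun h ↦ hyK (subset_realFill _ h)
  have him : 0 ≤ y.im := by
    rw [show upperHalfPlaneSet = {z : ℂ | 0 < z.im} from rfl, closure_setOf_lt_im] at hy; exact hy
  rcases him.lt_or_eq with hpos | hzero
  · have : y ∈ domain W S := by rw [← diff_closure_hull hW]; exact ⟨hpos, hyK'⟩
    exact ((mem_domain_iff _ _ _).1 this).2
  · have hyre : y = ((y.re : ℝ) : ℂ) := Complex.ext (by simp) (by simp [← hzero])
    have hW0K : ((W 0 : ℝ) : ℂ) ∈ closure (hull W S) := driving_mem_closure_hull hW hS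
    have hne : ((y.re : ℝ) : ℂ) ≠ ((W 0 : ℝ) : ℂ) := fun h ↦ hyK' (by rw [hyre, h]; exact hW0K)
    have h := lt_swallowingTime_of_notMem_closure_hull_holds hW hne (t := S) (by rw [← hyre]; exact hyK')
    rwa [← hyre] at h

/-- **The Euler hulls `B_N ∈ 𝒜₀` converge to `K = closure (K_S)`** in the sense of [LSW] p. 12
on compacts of `ℍ̄ ∖ K'` (`LSWClosedConverges`), for the restriction map `Φ_S = g_S - g_S(0)`:
(ii) for a compact `C ⊆ ℍ̄` missing `K'`, thicken it to `C'` still missing `K'`; all its points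
flow beyond `S` (`lt_swallowingTime_of_notMem_realFill`) at distance `≥ δ` from `W`
(`exists_forall_le_norm_map_sub`), so for large `N` every point of `C' ∩ ℍ` has all its Euler
steps alive and is off `B_N` (`mem_diff_eulerStage`) — whence `C ∩ B_N = ∅`, `B_N` being the
closure of its part in `ℍ` — with `|Φ_{B_N} - Φ_S| ≤ |G^E_{N+1} - g_S| + |c_{N+1} - g_S(0)|`
small (`eulerMap_eq`, `eulerMap_zero`, `dist_eulerMap_map_le`); (i) the annulus: a small closed
half-disc about `0` is such a compact, and far points flow `δ`-away from `W` by Lawler's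
Lemma 4.13 (`lt_swallowingTime_of_far`), so are eventually off `B_N`; finitely many `B_N` are
adjusted by `exists_forall_subset_annulus`. [cite: LawlerSchrammWerner2003Restriction, proof of Lemma 3.5 (p. 13)] -/
theorem lswClosedConverges_eulerStage :
    LSWClosedConverges (closure (hull W S)) (normalizedMap S hW)
      (fun N ↦ (eulerStage W S N (N + 1)).hull) (fun N ↦ (eulerStage W S N (N + 1)).rmap) := by
  have hK0 : (0 : ℂ) ∉ closure (hull W S) := hKp.1.2
  have h0 : (S : WithTop ℝ≥0) < swallowingTime W 0 := lt_swallowingTime_zero hW hW0.ne' hK0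
  obtain ⟨lam, hlam, hU⟩ := exists_forall_le_driving_sub_map_zero hW hW0 h0
  have hKne : (closure (hull W S)).Nonempty := (hull_nonempty hW hS).mono subset_closure
  have hKc : IsCompact (closure (hull W S)) := hKp.1.isBoundedHull.isCompact
  have hFc : IsClosed (realFill (closure (hull W S))) := (isCompact_realFill hKc).isClosed
  have hF0 : (0 : ℂ) ∉ realFill (closure (hull W S)) := hKp.zero_notMem_realFill hKne
  have hBstar : ∀ N, IsStarHull (eulerStage W S N (N + 1)).hull := fun N ↦
    (eulerStage W S N (N + 1)).isStarHull
  have hlam' : (0 : ℝ≥0) < ⟨lam, hlam.le⟩ := by exact_mod_cast hlam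
  -- `0` is a good point for every `δ ≤ λ₋`
  have hfar0 : ∀ {δ : ℝ≥0}, (δ : ℝ) ≤ lam → ∀ t : ℝ≥0, t ≤ S → (δ : ℝ) ≤ ‖map W t 0 - W t‖ := by
    intro δ hδlam t ht
    have h1 := abs_re_le_norm (map W t 0 - W t)
    rw [Complex.sub_re, Complex.ofReal_re] at h1
    have h2 := hU t ht
    have h3 : |(map W t 0).re - W t| = W t - (map W t 0).re := by
      rw [abs_sub_comm, abs_of_nonneg (by linarith)]
    linarith
  -- KEY CLAIM: compacts of `ℍ̄ ∖ K'` are eventually missed, with uniform convergence on them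
  have claim : ∀ C : Set ℂ, IsCompact C → C ⊆ closure upperHalfPlaneSet →
      Disjoint C (realFill (closure (hull W S))) →
      (∀ᶠ N in atTop, Disjoint C (eulerStage W S N (N + 1)).hull) ∧
        ∀ ε > 0, ∀ᶠ N in atTop, ∀ y ∈ C ∩ upperHalfPlaneSet,
          dist (normalizedMap S hW y) ((eulerStage W S N (N + 1)).rmap y) < ε := by
    intro C hC hCH hCF
    obtain ⟨r, hr, hrdisj⟩ := hCF.exists_cthickenings hC hFc
    have hdisj' : Disjoint (cthickening r C) (realFill (closure (hull W S))) :=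
      hrdisj.mono_right (self_subset_cthickening _)
    set C' : Set ℂ := cthickening r C ∩ closure upperHalfPlaneSet with hC'
    have hC'c : IsCompact C' := hC.cthickening.inter_right isClosed_closure
    have hC'T : ∀ y ∈ C', (S : WithTop ℝ≥0) < swallowingTime W y := fun y hy ↦
      lt_swallowingTime_of_notMem_realFill hW hS hy.2 (fun h ↦ Set.disjoint_left.1 hdisj' hy.1 h)
    obtain ⟨δC, hδC, hfarC⟩ := exists_forall_le_norm_map_sub hW hC'c hC'T
    set δ : ℝ≥0 := min δC ⟨lam, hlam.le⟩ with hδdef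
    have hδ : 0 < δ := lt_min hδC hlam'
    have hδlam : (δ : ℝ) ≤ lam := by
      have : δ ≤ ⟨lam, hlam.le⟩ := min_le_right _ _
      exact_mod_cast this
    have hgoodC : ∀ y ∈ C', ∀ t : ℝ≥0, t ≤ S → (δ : ℝ) ≤ ‖map W t y - W t‖ := fun y hy t ht ↦
      (NNReal.coe_le_coe.2 (min_le_left _ _)).trans (hfarC y hy t ht)
    have hCC' : C ⊆ C' := fun y hy ↦ ⟨self_subset_cthickening _ hy, hCH hy⟩
    refine ⟨?_, fun ε hε ↦ ?_⟩
    · filter_upwards [eventually_euler_good hW hW0 hKp hU hδ hδlam one_pos] with N hN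
      obtain ⟨hlev, hgood⟩ := hN
      refine Set.disjoint_left.2 fun y hyC hyB ↦ ?_
      -- `y ∈ B = closure (B ∩ ℍ)`: a point of `B ∩ ℍ` within `r` of `y` is good, hence off `B`
      rw [← (hBstar N).isBoundedHull.closure_inter_eq, Metric.mem_closure_iff] at hyB
      obtain ⟨y', ⟨hy'B, hy'H⟩, hyy'⟩ := hyB r hr
      have hy'C' : y' ∈ C' :=
        ⟨mem_cthickening_of_dist_le y' y r C hyC (by rw [dist_comm]; exact hyy'.le), subset_closure hy'H⟩
      obtain ⟨halive, -⟩ := hgood y' (hC'T y' hy'C') (hgoodC y' hy'C')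
      exact (mem_diff_eulerStage hy'H hlev halive).2 hy'B
    · filter_upwards [eventually_euler_good hW hW0 hKp hU hδ hδlam (show (0 : ℝ) < ε / 3 by positivity)]
        with N hN
      obtain ⟨hlev, hgood⟩ := hN
      rintro y ⟨hyC, hyH⟩
      have hyC' : y ∈ C' := hCC' hyC
      obtain ⟨halive, hdist⟩ := hgood y (hC'T y hyC') (hgoodC y hyC')
      obtain ⟨-, hdist0⟩ := hgood 0 h0 (hfar0 hδlam)
      rw [eulerMap_zero hlev] at hdist0
      have hc := re_sub_le_of_dist_le hdist0
      have heq := eulerMap_eq (z := y) hlev halive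
      have hχ : ((eulerStage W S N (N + 1)).rmap y : ℂ) =
          eulerMap W S N (N + 1) y - (eulerOffset W S N (N + 1) : ℂ) := by
        rw [heq]; ring
      rw [normalizedMap_apply, hχ, dist_eq_norm]
      rw [dist_eq_norm] at hdist
      calc ‖map W S y - (((map W S 0).re : ℝ) : ℂ) -
              (eulerMap W S N (N + 1) y - (eulerOffset W S N (N + 1) : ℂ))‖
          = ‖-(eulerMap W S N (N + 1) y - map W S y) +
              (((eulerOffset W S N (N + 1) - (map W S 0).re : ℝ) : ℂ))‖ := by
            push_cast; ring_nf
        _ ≤ ‖-(eulerMap W S N (N + 1) y - map W S y)‖ +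
              ‖(((eulerOffset W S N (N + 1) - (map W S 0).re : ℝ) : ℂ))‖ := norm_add_le _ _
        _ ≤ ε / 3 + ε / 3 := by
            rw [norm_neg, Complex.norm_real, Real.norm_eq_abs]
            exact add_le_add hdist hc
        _ < ε := by linarith
  refine ⟨?_, fun C hC hCH hCF ↦ ⟨(claim C hC hCH hCF).1, ?_⟩⟩
  · -- (i) the common annulus: inner radius
    obtain ⟨ε₀, hε₀, hε₀F⟩ := Metric.isOpen_iff.1 hFc.isOpen_compl 0 hF0
    set C₁ : Set ℂ := closedBall (0 : ℂ) (ε₀ / 2) ∩ closure upperHalfPlaneSet with hC₁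
    have hC₁c : IsCompact C₁ := (isCompact_closedBall _ _).inter_right isClosed_closure
    have hC₁F : Disjoint C₁ (realFill (closure (hull W S))) := Set.disjoint_left.2 fun z hz hzF ↦
      hε₀F (closedBall_subset_ball (by linarith) hz.1) hzF
    have hin := (claim C₁ hC₁c inter_subset_right hC₁F).1
    -- outer radius, by Lawler's Lemma 4.13
    obtain ⟨Mw, hMw0, hMw⟩ := exists_forall_norm_driving_sub_le hW S 0
    set δf : ℝ := 2 * Real.sqrt S + 1 with hδfdef
    have hδf : 0 < δf := by positivity
    have hδfS : 4 * (S : ℝ) ≤ δf ^ 2 := by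
      have h1 : Real.sqrt S ^ 2 = S := Real.sq_sqrt S.coe_nonneg
      nlinarith [Real.sqrt_nonneg (S : ℝ)]
    set R₀ : ℝ := Mw + 2 * δf with hR₀def
    have hR₀ : 0 < R₀ := by positivity
    set δ' : ℝ≥0 := min ⟨δf, hδf.le⟩ ⟨lam, hlam.le⟩ with hδ'def
    have hδ'0 : 0 < δ' := lt_min (by exact_mod_cast hδf) hlam'
    have hδ'lam : (δ' : ℝ) ≤ lam := by
      have : δ' ≤ ⟨lam, hlam.le⟩ := min_le_right _ _
      exact_mod_cast this
    have hδ'f : (δ' : ℝ) ≤ δf := by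
      have : δ' ≤ ⟨δf, hδf.le⟩ := min_le_left _ _
      exact_mod_cast this
    have hout : ∀ᶠ N in atTop, ∀ y ∈ upperHalfPlaneSet, R₀ ≤ ‖y‖ →
        y ∉ (eulerStage W S N (N + 1)).hull := by
      filter_upwards [eventually_euler_good hW hW0 hKp hU hδ'0 hδ'lam one_pos] with N hN y hyH hyR hyB
      obtain ⟨hlev, hgood⟩ := hN
      have hfar := lt_swallowingTime_of_far hW (t := S) (c := 0) (z := y) hMw hδf hδfS
        (by rw [sub_zero]; exact hyR)
      obtain ⟨halive, -⟩ := hgood y hfar.1 (fun t ht ↦ hδ'f.trans (hfar.2 t ht).1)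
      exact (mem_diff_eulerStage hyH hlev halive).2 hyB
    have hev : ∀ᶠ N in atTop, (eulerStage W S N (N + 1)).hull ⊆
        {z : ℂ | min (ε₀ / 2) R₀⁻¹ ≤ ‖z‖ ∧ ‖z‖ ≤ (min (ε₀ / 2) R₀⁻¹)⁻¹} := by
      filter_upwards [hin, hout] with N hN1 hN2 z hz
      have hzH' : z ∈ closure upperHalfPlaneSet := (hBstar N).isBoundedHull.subset_closure hz
      refine ⟨(min_le_left _ _).trans (le_of_not_gt fun hlt ↦
        Set.disjoint_left.1 hN1 ⟨mem_closedBall_zero_iff.2 hlt.le, hzH'⟩ hz), ?_⟩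
      have hsub : (eulerStage W S N (N + 1)).hull ∩ upperHalfPlaneSet ⊆ closedBall 0 R₀ :=
        fun w hw ↦ mem_closedBall_zero_iff.2 (le_of_not_ge fun hle ↦ hN2 w hw.2 hle hw.1)
      have hzR : ‖z‖ ≤ R₀ := by
        have h1 : z ∈ closure ((eulerStage W S N (N + 1)).hull ∩ upperHalfPlaneSet) := by
          rw [(hBstar N).isBoundedHull.closure_inter_eq]; exact hz
        have h2 := closure_mono hsub h1
        rw [closure_closedBall] at h2
        exact mem_closedBall_zero_iff.1 h2
      have h3 := inv_anti₀ (lt_min (half_pos hε₀) (inv_pos.2 hR₀)) (min_le_right (ε₀ / 2) R₀⁻¹)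
      rw [inv_inv] at h3
      exact hzR.trans h3
    exact exists_forall_subset_annulus hBstar (lt_min (half_pos hε₀) (inv_pos.2 hR₀)) hev
  · rw [Metric.tendstoUniformlyOn_iff]
    intro ε hε
    exact (claim C hC hCH hCF).2 ε hε

/-- **`K = closure (K_S)` is a limit of `𝒜₀` in the sense of [LSW] p. 12** for EVERY restriction
map `Φ` of `K` (they agree with `Φ_S` on `ℍ ∖ K`, `IsStarHull.existsUnique_isRestrictionMap`):
the hulls `B_N ∈ 𝒜₀` of the Euler scheme with their restriction maps `Φ_{B_N}`.
[cite: LawlerSchrammWerner2003Restriction, proof of Lemma 3.5 (p. 13)] -/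
theorem exists_lswClosedConverges_closure_hull
    {Φ : ConformalEquiv (upperHalfPlaneSet \ closure (hull W S)) upperHalfPlaneSet}
    (hΦ : IsRestrictionMap (closure (hull W S)) Φ) :
    ∃ (An : ℕ → Set ℂ) (Φn : ∀ n, ConformalEquiv (upperHalfPlaneSet \ An n) upperHalfPlaneSet),
      (∀ n, IsLSWGenerated (An n)) ∧ (∀ n, IsRestrictionMap (An n) (Φn n)) ∧
        LSWClosedConverges (closure (hull W S)) Φ An Φn := by
  have h := lswClosedConverges_eulerStage hW hS hW0 hKp
  have h0 : (S : WithTop ℝ≥0) < swallowingTime W 0 := lt_swallowingTime_zero hW hW0.ne' hKp.1.2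
  obtain ⟨Φ₀, -, huniq⟩ := IsStarHull.existsUnique_isRestrictionMap_holds hKp.1
  have hEq : EqOn (normalizedMap S hW) Φ (upperHalfPlaneSet \ closure (hull W S)) := fun z hz ↦ by
    rw [huniq _ (isRestrictionMap_normalizedMap h0) hz, huniq Φ hΦ hz]
  refine ⟨fun N ↦ (eulerStage W S N (N + 1)).hull, fun N ↦ (eulerStage W S N (N + 1)).rmap,
    fun N ↦ (eulerStage W S N (N + 1)).isLSWGenerated,
    fun N ↦ (eulerStage W S N (N + 1)).isRestrictionMap, h.1,
    fun C hC hCH hCF ↦ ⟨(h.2 C hC hCH hCF).1, ?_⟩⟩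
  refine ((h.2 C hC hCH hCF).2).congr_right fun z hz ↦ hEq ⟨hz.2, fun h' ↦ ?_⟩
  exact Set.disjoint_left.1 hCF hz.1 (subset_realFill _ h')

end Approx

end Loewner

/-! ### [LSW] Lemma 3.5 from Loewner's theorem -/

/-- NAMED FACT — **Loewner's theorem for the boundary path of a smooth hull** ([LSW] proof of
Lemma 3.5, p. 13, verbatim: "Note that `∂E_δ ∩ ℍ̄` is a simple path, say `β : [0, s] → ℍ̄` with
`β(0), β(s) ∈ ℝ`. We may assume that `β` is parametrized by half-plane capacity from `∞`, so
that `a(β[0, t]) = 2t`, `t ∈ [0, s]`. Set `g_t := g_{β[0,t]}`, `Φ_t := Φ_{β[0,t]} = g_t - g_t(0)`,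
`U_t := g_t(β(t))` … By the chordal version of Loewner's theorem, we have
`∂_t g_t(z) = 2/(g_t(z) - U_t)`", used up to and including the terminal time, where
"`Φ_s(z) = Φ_{E_δ}`"; the chordal Loewner theorem for a simple curve is Lawler (2005),
Prop. 4.4 with Lemma 4.2 (`U_t` continuous, `U_0 = γ(0)`) and Remark 4.5 (reparametrization by
capacity)). In the tree's terms (`LoewnerChain`: the chain `ġ = 2/(g - W)` has hulls
`Loewner.hull W t` of half-plane capacity `2t`): for `A ∈ 𝒬₊` whose boundary in `ℍ` is a simple
path `γ` with two real endpoints (`IsArcHull`, the data of its definition repeated as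
hypotheses), there are a continuous driving function `W` with `W_0 = γ(0)`, a terminal time
`S > 0` and an increasing reparametrization `σ : [0, S] → [0, 1]` such that the Loewner hull at
each time `t < S` is the initial arc `γ(σ(0, t])` and the hull at time `S` is `A ∩ ℍ`.
[cite: LawlerSchrammWerner2003Restriction, proof of Lemma 3.5 (p. 13), "By the chordal version of Loewner's theorem"] -/
def IsArcHull.exists_loewner_chain : Prop :=
  ∀ {A : Set ℂ}, IsArcHull A → IsPlusHull A →
    ∀ {γ : ℝ → ℂ}, ContinuousOn γ (Icc 0 1) → InjOn γ (Icc 0 1) → (γ 0).im = 0 → (γ 1).im = 0 →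
      (∀ t ∈ Ioo (0 : ℝ) 1, 0 < (γ t).im) → upperHalfPlaneSet ∩ frontier A = γ '' Ioo 0 1 →
      ∃ (W : ℝ≥0 → ℝ) (S : ℝ≥0) (σ : ℝ≥0 → ℝ), Continuous W ∧ 0 < S ∧ (W 0 : ℂ) = γ 0 ∧
        ContinuousOn σ (Iic S) ∧ StrictMonoOn σ (Iic S) ∧ σ 0 = 0 ∧ σ S = 1 ∧
        (∀ t : ℝ≥0, t < S → Loewner.hull W t = γ '' (σ '' Ioc 0 t)) ∧
        Loewner.hull W S = A ∩ upperHalfPlaneSet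

/-- The starting point `γ(0)` of the boundary arc of a smooth hull lies in the hull. [folklore] -/
theorem IsArcHull.apply_zero_mem {A : Set ℂ} (hA : IsArcHull A) {γ : ℝ → ℂ}
    (hγc : ContinuousOn γ (Icc 0 1)) (hfr : upperHalfPlaneSet ∩ frontier A = γ '' Ioo 0 1) :
    γ 0 ∈ A := by
  have h0 : ContinuousWithinAt γ (Ioo 0 1) 0 :=
    (hγc 0 ⟨le_rfl, zero_le_one⟩).mono Ioo_subset_Icc_self
  have hcl : (0 : ℝ) ∈ closure (Ioo (0 : ℝ) 1) := by
    rw [closure_Ioo zero_ne_one]; exact ⟨le_rfl, zero_le_one⟩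
  have h1 := h0.mem_closure_image hcl
  rw [← hfr] at h1
  have h2 : closure (upperHalfPlaneSet ∩ frontier A) ⊆ A :=
    (closure_mono inter_subset_right).trans
      (by rw [isClosed_frontier.closure_eq]; exact frontier_subset_iff_isClosed.2 hA.1.isClosed)
  exact h2 h1

/-- **The hulls `E_δ` are limits of `𝒜₀`, from Loewner's theorem** ([LSW] proof of Lemma 3.5,
p. 13): the named fact `IsArcHull.exists_isLSWGenerated_lswClosedConverges` of
`RestrictionDensityArc` follows from `IsArcHull.exists_loewner_chain` by the (proved) Euler
scheme `Loewner.exists_lswClosedConverges_closure_hull`.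
[cite: LawlerSchrammWerner2003Restriction, proof of Lemma 3.5 (p. 13)] -/
theorem IsArcHull.exists_isLSWGenerated_lswClosedConverges_of_loewner
    (hL : IsArcHull.exists_loewner_chain) : IsArcHull.exists_isLSWGenerated_lswClosedConverges := by
  intro A hA hAp Φ hΦ
  obtain ⟨γ, hγc, hγi, hγ0, hγ1, hγH, hfr⟩ := hA.2
  obtain ⟨W, S, σ, hW, hS, hW0, -, -, -, -, -, hKS⟩ := hL hA hAp hγc hγi hγ0 hγ1 hγH hfr
  have hK : closure (Loewner.hull W S) = A := by rw [hKS, hA.1.closure_inter_eq]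
  have hW0' : 0 < W 0 := hAp.2 (W 0) (by rw [hW0]; exact hA.apply_zero_mem hγc hfr)
  subst hK
  exact Loewner.exists_lswClosedConverges_closure_hull hW hS hW0' hAp hΦ

/-- **The density of `𝒜₀` in `𝒬₊` ([LSW] Lemma 3.5, the named fact
`IsPlusHull.exists_isLSWGenerated_lswConverges` of `RestrictionDensity`) follows from Loewner's
theorem** (`IsArcHull.exists_loewner_chain`), everything else in the printed proof — outer
approximation by the `E_δ`, the Euler scheme for the Loewner flow, the identification of the
frozen pieces with the generators `λK_t`, and the diagonal extraction — being proved in the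
tree. [cite: LawlerSchrammWerner2003Restriction, Lemma 3.5 and its proof (pp. 12–13)] -/
theorem IsPlusHull.exists_isLSWGenerated_lswConverges_of_loewner
    (hL : IsArcHull.exists_loewner_chain) : IsPlusHull.exists_isLSWGenerated_lswConverges :=
  IsPlusHull.exists_isLSWGenerated_lswConverges_of_arcHull
    (IsArcHull.exists_isLSWGenerated_lswClosedConverges_of_loewner hL)

end Literature.Probability.RandomPlanarGeometry

end
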